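import Mathlib
import Summits.MatrixMultiplication.MatrixMultiplication.Theses.ThinBlockAlpha
import Summits.MatrixMultiplication.MatrixMultiplication.Theses.GroupTheoreticSTPP
import Summits.MatrixMultiplication.MatrixMultiplication.Theorems.ThinPackings.Negative.ThinPackingsIffCThesis

/-!
# Line `truncated-convolution-designs` — crux `ThinBlockAlpha.ThinPackings` (stmt-MatrixMultiplication-10595)

Crux-strategist line (wall-breaker gen 2, planner-cstrat-stmt-MatrixMultiplication-10595-p2-0, 2026-08-17).
Card: `Lines/truncated-convolution-designs.md`.  Namespace `…Cruxes.ThinPackings.TruncatedConvolutionDesigns`.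

THE MECHANISM (the door in the frame wall).  A *stacked-window integer design* at base `ℓ` is an `IsSTPP` family in
the free abelian group `ℤ^N = (Fin N → ℤ)` whose three within-block difference vectors `s − t`, `t − u`, `s − u`
(`s ∈ A i`, `t ∈ B i`, `u ∈ C i`) are DIGIT VECTORS in `[0, ℓ)^N` (the legs are stacked `C ≤ B ≤ A` inside a window of
length `ℓ` in every coordinate) and whose legs have CONSTANT DIGIT SUMS (`Σ_c s_c = σ_A` on `⋃ A i`, etc.).  Forgetting the
slice, such designs are exactly the zero-outs of tensor powers of the truncated convolution tensor
`T_ℓ^lower = Σ_{i+j<ℓ} x_i y_j z_{i+j}` (structure tensor of `ℤ[x]/(x^ℓ)`, border rank `ℓ`) into disjoint matrix products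
(variables `x = s − t`, `y = t − u`, `z = s − u`; a matrix-product sub-support of an addition tensor is a TPP triple — the
cocycle identity), and the slice is one more zero-out of polynomial cost.  Coppersmith–Winograd's `CW_{ℓ-2}` is the
level-typed sub-design of this tensor (Alman–Vassilevska Williams, ITCS 2018, arXiv:1712.07246, §3.2: `CW_q ⊆ T_{q+2}`;
§1(3), about the cyclic tensors `T_q`: "for variable q … take q to infinity … it is not ruled out, and hence possible, that
one can obtain ω = 2 in this way"; p. 5: Cohn's remark that `CW_q` gives STPP families in `ℤ_m^n`).  HOSTING
(`stub_slicedHosting`, the tool): the base-`ℓ` value map `v ↦ Σ_c v_c ℓ^c` sends such a design to an `IsSTPP` family of the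
CYCLIC group `ℤ/ℓ^N` with the same block sizes — Kummer's carry identity (a relation `[X] + [Y] = [Z]` between digit
vectors with `ΣX + ΣY = ΣZ` is digitwise; tree `AutomaticDesignBelowFourFifths.stub_digitwise`, PROVED) kills every carry
including the top wrap, so NO margin digits and NO factor-`3^N` box loss are paid: the per-coordinate host price is the
window length `ℓ` itself.  This is the generalisation of the tree's PROVED cyclic design certifying `ω ≤ 2.4`
(`Theorems/AutomaticSTPPDesignsAutomaticDesignBelowFourFifths*.lean`: CW₆ level 1 in `ℤ/8^N`, `ω < 2.38719`), and it is
what the two dead frame lines lacked (their carry-free boxes `[-b,b]^D ↪ ℤ/(6b+1)^D` pay `6b+1` per coordinate for legs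
of width `2b+1`; `WeakNoExcess`, p116358, is a statement about that price).  READING TWO (`stub_boundedReading`, honesty
lemma): the same design reduced coordinatewise mod `ℓ` is an `IsSTPP` family of `(ℤ/ℓ)^N` — bounded exponent `ℓ` — so
every base is capped by Theorem B (`a ≤ a₀(ℓ)`, `ω ≥ 2 + ε_ℓ`; tensor form: `ω_u(T_ℓ^lower) ≥ 2 log ℓ / log S̃(T_ℓ^lower)`,
Alman 2019 §5.3, `→ 2` as `ℓ → ∞`), and the heart lets `ℓ = ℓ(ε) → ∞`.  HEART (`stub_windowDesigns`): for every `ε > 0`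
some base `ℓ` carries a stacked-window design with `Σ_i (|A i||B i||C i|)^{(2+ε)/3} > ℓ^N` — the abelian-STPP form of the
AVW programme.  `ThinPackings_of` composes hosting + heart into `CThesis` (cyclic witnesses) and then into the crux BY NAME
through the landed costume theorem `not_thinPackings_iff_not_cThesis` (p76748).

WHY IT IS NOT THE DEAD / LIVE LINES.  Frames (three-sphere, label-weighted): carry-FREE boxes, killed by the `6b+1` price
(NoExcess) — here the price is `ℓ` for window `ℓ`, and volume excess is a theorem (the CW₆ design has `Σ vol^{0.8} > 8^N`).
Log-flat / orbit lines: multiplicative resp. ≡ crux — this class is additive-positional and NOT closed under the c4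
normal form (an arbitrary cyclic witness is not a sliced digit design: at `N = 1` constant digit sums force singleton
legs, which certify nothing).  Cyclic-carry-charts (live): complementary — its certificates are LOCAL carry motifs and
its host advantage is the absence of Thm B; this line's certificate is the GLOBAL digit-sum slice, its designs are
carry-free, Thm-B-capped per base, and its design source is the laser method's typed free diagonals on `T_ℓ^lower`
(every zero-out laser design on `CW_q` powers transfers: the class certifies the laser state of the art, `2.3714`, on paper,
`2.38719` in the kernel).  Two-families: independent of stmt-0595.

Disproof used: Disproof.lean has no `_false_without_` theorem and no landed Negative lemma on digit designs; §7 costume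
theorem is USED (the composition runs through `CThesis`); §3b (`η = 0` false, bounded `N` false, bounded exponent false)
is honoured by `stub_boundedReading` + "ℓ(ε) → ∞"; §6 cores: legs of distinct blocks are not translates (distinct level
data).  Negatives index (7): no statement about cyclic or integer digit designs.
-/

set_option linter.dupNamespace false

namespace Summit.MatrixMultiplication.MatrixMultiplication.Cruxes.ThinPackings.TruncatedConvolutionDesigns

open Finset Literature.Computability.AlgebraicComplexity
open Summit.MatrixMultiplication.MatrixMultiplication.Theses.ThinBlockAlpha (ThinPackings)
open Summit.MatrixMultiplication.MatrixMultiplication.Theses.GroupTheoreticSTPP (CThesis)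

/-! ## Definitions -/

/-- Base-`ℓ` value map of an integer vector into the cyclic group `ℤ/ℓ^N`: `v ↦ Σ_c v_c · ℓ^c`. -/
def toCyclic (ℓ N : ℕ) (v : Fin N → ℤ) : ZMod (ℓ ^ N) :=
  ∑ c : Fin N, (v c : ZMod (ℓ ^ N)) * (ℓ : ZMod (ℓ ^ N)) ^ (c : ℕ)

/-- Coordinatewise reduction mod `ℓ` of an integer vector (the bounded-exponent reading). -/
def toHomocyclic (ℓ N : ℕ) (v : Fin N → ℤ) : Fin N → ZMod ℓ :=
  fun c => (v c : ZMod ℓ)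

/-- **Stacked windows at base `ℓ`.**  Within every block the three difference vectors `s − t`, `t − u`, `s − u`
(`s ∈ A i`, `t ∈ B i`, `u ∈ C i`) are digit vectors: all coordinates in `[0, ℓ)`.  (Per coordinate the legs are stacked
`C ≤ B ≤ A` inside a window of length `ℓ`; e.g. CKSU-type coordinates `(D, {0}, {0})` become `(D, {0}, {0})`,
`({ℓ-1}, D, {0})`, `({ℓ-1}, {ℓ-1}, D)` on the A-, B-, C-active legs, and CW's level cells are of this form.) -/
def WindowStacked {N L : ℕ} (ℓ : ℕ) (A B C : Fin L → Finset (Fin N → ℤ)) : Prop :=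
  ∀ i : Fin L,
    (∀ s ∈ A i, ∀ t ∈ B i, ∀ c, 0 ≤ s c - t c ∧ s c - t c < ℓ) ∧
    (∀ t ∈ B i, ∀ u ∈ C i, ∀ c, 0 ≤ t c - u c ∧ t c - u c < ℓ) ∧
    (∀ s ∈ A i, ∀ u ∈ C i, ∀ c, 0 ≤ s c - u c ∧ s c - u c < ℓ)

/-- **Constant digit sums per leg** (the slice): all elements of all `A i` have one coordinate sum `σ_A`, likewise
`σ_B`, `σ_C`.  This is what makes every would-be carry chain in `ℤ/ℓ^N` collapse (Kummer). -/
def ConstDigitSums {N L : ℕ} (A B C : Fin L → Finset (Fin N → ℤ)) : Prop :=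
  ∃ σA σB σC : ℤ, (∀ i, ∀ s ∈ A i, ∑ c, s c = σA) ∧ (∀ i, ∀ t ∈ B i, ∑ c, t c = σB) ∧
    (∀ i, ∀ u ∈ C i, ∑ c, u c = σC)

/-- All legs of all blocks are nonempty (WLOG for packing sums; needed for injectivity of the host maps on legs). -/
def LegsNonempty {H : Type} {L : ℕ} (A B C : Fin L → Finset H) : Prop :=
  ∀ i : Fin L, (A i).Nonempty ∧ (B i).Nonempty ∧ (C i).Nonempty

/-! ## Statements of the stubs as named `Prop`s (`Stmt.stub_*`) -/
namespace Stmt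

/-- Statement of `stub_slicedHosting` (TOOL, L).  **Sliced hosting in the cyclic group.**  A stacked-window integer
`IsSTPP` family at base `ℓ ≥ 2` with constant digit sums maps under `toCyclic ℓ N` to an `IsSTPP` family of `ℤ/ℓ^N` with
the same block sizes.  Proof plan (generalising the tree's `AutomaticDesignBelowFourFifths.slicedSTPP_kernel` /
`stub_digitwise`, both PROVED): a relation between images reads `[X] + [Y] = [Z]` for the digit vectors `X = s' − t`,
`Y = t' − u`, `Z = s − u'` (`WindowStacked`), whose digit sums satisfy `ΣX + ΣY = (σ_A − σ_B) + (σ_B − σ_C) = ΣZ`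
(`ConstDigitSums`); Kummer's carry identity (`digitwise_carry_eq_zero`: carries are `≥ 0` and sum to `0`) makes it
digitwise, i.e. `(s' − s) + (t' − t) + (u' − u) = 0` in `ℤ^N`, and the integer `IsSTPP` concludes; block sizes: two
elements of one leg differ by a vector in `(−ℓ, ℓ)^N` (subtract a common partner from the other legs, `LegsNonempty`), on
which `toCyclic` vanishes only at `0` (balanced digits, induction on the lowest coordinate). -/
def stub_slicedHosting : Prop :=
  ∀ (ℓ N L : ℕ), 2 ≤ ℓ → ∀ (A B C : Fin L → Finset (Fin N → ℤ)),
    IsSTPP A B C → WindowStacked ℓ A B C → ConstDigitSums A B C → LegsNonempty A B C →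
      IsSTPP (fun i => (A i).image (toCyclic ℓ N)) (fun i => (B i).image (toCyclic ℓ N))
          (fun i => (C i).image (toCyclic ℓ N)) ∧
        ∀ i : Fin L, ((A i).image (toCyclic ℓ N)).card = (A i).card ∧
          ((B i).image (toCyclic ℓ N)).card = (B i).card ∧ ((C i).image (toCyclic ℓ N)).card = (C i).card

/-- Statement of `stub_boundedReading` (HONESTY LEMMA / BY-PRODUCT, M).  **The bounded-exponent reading.**  The same
design reduced coordinatewise mod `ℓ` is an `IsSTPP` family of the homocyclic group `(ℤ/ℓ)^N` (exponent `ℓ`) with the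
same block sizes.  Proof plan: mod `ℓ` the relation gives `X_c + Y_c − Z_c ∈ {0, ℓ}` in every coordinate (it is `≡ 0`
and lies in `(−ℓ, 2ℓ)`), the digit sums give `Σ_c (X_c + Y_c − Z_c) = 0`, hence digitwise; injectivity on legs as in
`stub_slicedHosting`.  CONSEQUENCE (with the tree's Thm B, `BlasiakChurchCohnGrochowNaslundSawinUmans2017_B_holds`): for
every base `ℓ` there is `ε_ℓ > 0` that no stacked-window design at base `ℓ` beats — the heart must let `ℓ(ε) → ∞`
(tensor form: Alman 2019 §5.3, `ω_u(T_ℓ^lower) ≥ 2 log ℓ / log S̃(T_ℓ^lower) > 2`, `→ 2`); and every design of this line is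
ALSO a witness for the bounded-exponent programme of crux `BoundedThinPackings` (stmt-14848). -/
def stub_boundedReading : Prop :=
  ∀ (ℓ N L : ℕ), 2 ≤ ℓ → ∀ (A B C : Fin L → Finset (Fin N → ℤ)),
    IsSTPP A B C → WindowStacked ℓ A B C → ConstDigitSums A B C → LegsNonempty A B C →
      IsSTPP (fun i => (A i).image (toHomocyclic ℓ N)) (fun i => (B i).image (toHomocyclic ℓ N))
          (fun i => (C i).image (toHomocyclic ℓ N)) ∧
        ∀ i : Fin L, ((A i).image (toHomocyclic ℓ N)).card = (A i).card ∧
          ((B i).image (toHomocyclic ℓ N)).card = (B i).card ∧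
          ((C i).image (toHomocyclic ℓ N)).card = (C i).card

/-- Statement of `stub_windowDesigns` (HEART, open; hardest).  **Stacked-window designs beat every exponent above 2.**
For every `ε > 0` some base `ℓ ≥ 2` carries a stacked-window integer `IsSTPP` family with constant digit sums whose
packing sum at exponent `(2+ε)/3` exceeds `ℓ^N`.  Equivalently (quasi-uniqueness of matrix-product sub-supports of an
addition tensor + global slicing, poly loss): zero-outs of powers of the truncated convolution tensors `T_ℓ^lower`
certify `ω ≤ 2 + ε` for every `ε`, i.e. `inf_ℓ ω_u^{zo}(T_ℓ^lower) = 2` — the carry-free integer form of the programme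
stated as "not ruled out" in Alman–Vassilevska Williams ITCS 2018 §1(3) (there for monomial degenerations of the cyclic
tensors `T_q`).  KNOWN RUNGS: `ε = 0.388`
(CW₆ level 1 at `ℓ = 8`, PROVED in the tree as `AutomaticDesignBelowFourFifths`), `ε ≈ 0.3714` on paper (every zero-out
laser design on `CW_5`/`CW_6` powers is such a design).  Why it might fail: per base it is capped (stub_boundedReading +
Thm B; Alman's `S̃(T_ℓ^lower)` table), so `ℓ(ε) → ∞` and the designs must use `T_ℓ^lower` far beyond its CW slice; the
strategist's onion computation (census gen 2 §T10) shows the natural extra entropy (mixing CW layers with the interior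
block `t₁₁₁ ≅ T_{ℓ-3}^lower`) is NON-LATIN and is confiscated by ball-type hashing penalties; a uniform-in-ℓ two-scale
Theorem B would refute it together with stmt-14848. -/
def stub_windowDesigns : Prop :=
  ∀ ε : ℝ, 0 < ε → ∃ (ℓ N L : ℕ) (A B C : Fin L → Finset (Fin N → ℤ)),
    2 ≤ ℓ ∧ IsSTPP A B C ∧ WindowStacked ℓ A B C ∧ ConstDigitSums A B C ∧ LegsNonempty A B C ∧
      ((ℓ ^ N : ℕ) : ℝ) < ∑ i, (((A i).card * (B i).card * (C i).card : ℕ) : ℝ) ^ ((2 + ε) / 3)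

end Stmt

/-! ## Registered stubs -/

/-- TOOL (L): sliced hosting in `ℤ/ℓ^N`, see `Stmt.stub_slicedHosting`. -/
theorem stub_slicedHosting : Stmt.stub_slicedHosting := by
  sorry

/-- HONESTY LEMMA / BY-PRODUCT (M): the bounded-exponent reading in `(ℤ/ℓ)^N`, see `Stmt.stub_boundedReading`. -/
theorem stub_boundedReading : Stmt.stub_boundedReading := by
  sorry

/-- HEART (open): stacked-window designs for every `ε`, see `Stmt.stub_windowDesigns`. -/
theorem stub_windowDesigns : Stmt.stub_windowDesigns := by
  sorry

/-! ## Compositions (kernel-checked, no sorry) -/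

/-- Hosting + heart ⇒ `CThesis` (stmt-0593) with CYCLIC witnesses `ℤ/ℓ^N`. -/
theorem cThesis_of (hH : Stmt.stub_slicedHosting) (hW : Stmt.stub_windowDesigns) : CThesis := by
  intro ε hε
  obtain ⟨ℓ, N, L, A, B, C, hℓ, hS, hwin, hsum, hne, hpack⟩ := hW ε hε
  obtain ⟨hS', hcard⟩ := hH ℓ N L hℓ A B C hS hwin hsum hne
  haveI : NeZero (ℓ ^ N) := ⟨pow_ne_zero _ (by omega)⟩
  refine ⟨ZMod (ℓ ^ N), inferInstance, inferInstance, L, fun i => (A i).image (toCyclic ℓ N),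
    fun i => (B i).image (toCyclic ℓ N), fun i => (C i).image (toCyclic ℓ N), hS', ?_⟩
  have hc : ∀ i : Fin L, (((A i).image (toCyclic ℓ N)).card * ((B i).image (toCyclic ℓ N)).card *
      ((C i).image (toCyclic ℓ N)).card : ℕ) = (A i).card * (B i).card * (C i).card := by
    intro i
    obtain ⟨h1, h2, h3⟩ := hcard i
    rw [h1, h2, h3]
  simp_rw [hc]
  rw [ZMod.card]
  exact hpack

/-- The line concludes the crux BY NAME: hosting + heart ⇒ `CThesis` ⇒ `ThinBlockAlpha.ThinPackings` through the
landed costume theorem `not_thinPackings_iff_not_cThesis` (Theorems/ThinPackings/Negative/ThinPackingsIffCThesis.lean,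
p76748). -/
theorem ThinPackings_of : Stmt.stub_slicedHosting → Stmt.stub_windowDesigns → ThinPackings := by
  intro hH hW
  by_contra h
  exact (Summit.MatrixMultiplication.MatrixMultiplication.Theorems.ThinPackings.Negative.not_thinPackings_iff_not_cThesis.mp
    h) (cThesis_of hH hW)

/-- The crux modulo the registered stubs. -/
theorem ThinPackings_proof : ThinPackings := ThinPackings_of stub_slicedHosting stub_windowDesigns

/-- BY-PRODUCT (modulo the reading stub): the heart also puts `CThesis` witnesses into HOMOCYCLIC groups `(ℤ/ℓ)^N`
(exponent `ℓ`) — the form Theorem B reads, whence `ℓ(ε) → ∞`; the same witnesses serve crux stmt-14848. -/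
theorem homocyclicWitness_of (hR : Stmt.stub_boundedReading) (hW : Stmt.stub_windowDesigns) :
    ∀ ε : ℝ, 0 < ε → ∃ (ℓ N L : ℕ) (A B C : Fin L → Finset (Fin N → ZMod ℓ)), 2 ≤ ℓ ∧ IsSTPP A B C ∧
      ((ℓ ^ N : ℕ) : ℝ) < ∑ i, (((A i).card * (B i).card * (C i).card : ℕ) : ℝ) ^ ((2 + ε) / 3) := by
  intro ε hε
  obtain ⟨ℓ, N, L, A, B, C, hℓ, hS, hwin, hsum, hne, hpack⟩ := hW ε hε
  obtain ⟨hS', hcard⟩ := hR ℓ N L hℓ A B C hS hwin hsum hne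
  refine ⟨ℓ, N, L, fun i => (A i).image (toHomocyclic ℓ N), fun i => (B i).image (toHomocyclic ℓ N),
    fun i => (C i).image (toHomocyclic ℓ N), hℓ, hS', ?_⟩
  have hc : ∀ i : Fin L, (((A i).image (toHomocyclic ℓ N)).card * ((B i).image (toHomocyclic ℓ N)).card *
      ((C i).image (toHomocyclic ℓ N)).card : ℕ) = (A i).card * (B i).card * (C i).card := by
    intro i
    obtain ⟨h1, h2, h3⟩ := hcard i
    rw [h1, h2, h3]
  simp_rw [hc]
  exact hpack

end Summit.MatrixMultiplication.MatrixMultiplication.Cruxes.ThinPackings.TruncatedConvolutionDesigns
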